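import Literature.AnabelianGeometry.SemiGraphs.WitnessIwahoriCuspChart
import Literature.AnabelianGeometry.SemiGraphs.TemperedSpecialFibreReductionsDescended
import HarnessLib

/-!
# A SINGLE certified special fibre with a cusp already violates [SemiAnbd] Cor. 3.11 step (S3)/(S3′) AS
# TYPED: the shear automorphism of `π₁^temp(cuspGraph p) = P` moves the cusp's edge group off its
# conjugacy class

Mochizuki, *Semi-graphs of anabelioids*, Publ. RIMS **42** (2006), §3, Corollary 3.11, proof pp. 46–48
[cite: MochizukiSemiAnbd2006, Cor 3.11 pp.46-48] ("extends uniquely to a natural, functorial isomorphism of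
semi-graphs of anabelioids `G^c[α]_Σ ⥲ G^c[β]_Σ`"), Def. 2.4 (iv) p. 26, Rmk. 2.4.2 p. 26 (morphisms of
semi-graphs of anabelioids are compatible with the branch maps up to conjugation).

Sequel (abc-iut cell, block F, seat abc-iut-f-177) of `WitnessIwahoriCuspChart.lean` (the explicit chart
`cuspChart p`, `π₁^temp = P = ℤ_p ⋊ (1 + pℤ_p)`, verticial homomorphisms = inner automorphisms) and of
`TemperedSpecialFibreReductionsSchemaS3(Cusps).lean` (FACT-LIST F-1727 / F-3254: cusp-omission PAIRS refute the
typed (S3)/(S3′) at all-certifying origins).  Here ONE datum suffices — the tempered-level, kernel-checked form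
of the cell's earlier finding F-w4d058g2-1 (abc-iut-w4-d058: "for `P¹ ∖ {0,1,∞}` the automorphism `a ↦ a`,
`b ↦ ba` of `Π_v` moves the cuspidal class of `ab` off every cuspidal class"):

* `Iw.shear c : P ≃ₜ* P`, `(a, s) ↦ (a + c s, s)` — the 1-cocycle `s ↦ c s` of `U = 1 + pℤ_p` with values in
  `ℤ_p`; it carries the torus `T_0 = b_0(U)` onto the twisted complement `T_c` (`Iw.shear_bHom_zero`), and
  `T_1` meets NO conjugate of `T_0` (tree: `Iw.range_bHom_inf_conj_eq_bot_of_ne`, the estrangement computation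
  of abc-iut-L3 WIT-1b — `H¹(U, ℤ_p) = ℤ_p/p ≠ 0`);
* `IwahoriWitness.not_chartCompatible_shear` — NO morphism `F : cuspGraph p → cuspGraph p` of semi-graphs of
  anabelioids is chart-compatible with `shear 1` for `cuspChart p`: compatibility at the vertex forces
  `shear 1 = Inn(g) ∘ F_v` (verticial homomorphisms are inner), and `F_v(T_0) ⊆ g′ T_0 g′⁻¹` by the branch
  compatibility of Rmk. 2.4.2, so `T_1 = shear 1 (T_0)` would lie in a conjugate of `T_0`;
* **`IwahoriWitness.exists_cuspDatum_not_S3`** — over `ℚ_p`, ONE tempered arithmetic group `D` with ONE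
  special-fibre datum `S = (cuspGraph p, π₁^temp = P)` such that EVERY origin pair certifying `S` (on both
  sides) violates (S3) `SpecialFibreIsoOfChartIso` AND (S3′) `SpecialFibreIsoOfDescendedIso` (`φ := shear 1`,
  descended from `γ := adm⁻¹ ∘ shear 1 ∘ adm`); and (append) `exists_cuspDatum_not_cor311` — the typed
  `Cor311 p p` itself (FACT-LIST F-1721, same prime on both sides) fails there, through its ISOMORPHISM clause.

READING (honest): the typed (S3)/(S3′) demand that EVERY (descended) automorphism of `π₁^temp(G^c)` be
geometric; at a certified datum this fails as soon as the vertex group has a continuous automorphism moving a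
cusp's edge group off its conjugacy class — here for the witness group `P`, in print's setting for the free
profinite `Π_v` of a cusp-bearing component (F-w4d058g2-1).  Print's (i)–(iv) p. 47 use MORE than `φ`
(finite étale coverings of the CURVE inside `Δ[□]`).  The rows stay «schema; consumable BY NAME at a named
origin pair» (`corollary_3_11_of_steps(')`); nothing of [SemiAnbd] is refuted; nothing here bears on
[IUTchIII] Cor. 3.12.
-/

noncomputable section

namespace Literature.AnabelianGeometry.SemiGraphs

open ProfiniteSemiGraph Topology CategoryTheory IwahoriWitness

/-! ### The shear automorphisms of `P = ℤ_p ⋊ (1 + pℤ_p)` -/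

namespace Iw

variable {p : ℕ} [Fact p.Prime]

/-- **The shear automorphism** `(a, s) ↦ (a + c s, s)` of `P = ℤ_p ⋊ (1 + pℤ_p)` determined by the 1-cocycle
`s ↦ c s` (`c ∈ ℤ_p`): a continuous group automorphism carrying the torus `T_0` onto `T_c`.
[cite: MochizukiSemiAnbd2006, Def 2.4(iv) p.26] -/
def shear (c : ℤ_[p]) : Iw p ≃ₜ* Iw p where
  toFun x := ⟨x.a + c * x.s, x.s⟩
  invFun x := ⟨x.a - c * x.s, x.s⟩
  left_inv x := by ext <;> simp
  right_inv x := by ext <;> simp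
  map_mul' x y := by
    ext
    · simp only [mul_a, mul_s, w]
      ring
    · simp only [mul_s]
  continuous_toFun :=
    (continuous_mk_iff (p := p)).2 ⟨continuous_a.add (continuous_const.mul continuous_s), continuous_s⟩
  continuous_invFun :=
    (continuous_mk_iff (p := p)).2 ⟨continuous_a.sub (continuous_const.mul continuous_s), continuous_s⟩

/-- Coordinates of the shear. [cite: MochizukiSemiAnbd2006, Def 2.4(iv) p.26] -/
@[simp] theorem shear_a (c : ℤ_[p]) (x : Iw p) : (shear c x).a = x.a + c * x.s := rfl

/-- Coordinates of the shear. [cite: MochizukiSemiAnbd2006, Def 2.4(iv) p.26] -/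
@[simp] theorem shear_s (c : ℤ_[p]) (x : Iw p) : (shear c x).s = x.s := rfl

/-- **The shear carries the torus onto the twisted complement**: `shear c ∘ b_0 = b_c`.
[cite: MochizukiSemiAnbd2006, Def 2.4(iv) p.26] -/
theorem shear_bHom_zero (c : ℤ_[p]) (u : IwU p) : shear c (bHom 0 u) = bHom c u := by
  ext <;> simp

end Iw

/-! ### No morphism of `cuspGraph p` is chart-compatible with the shear -/

namespace IwahoriWitness

variable (p : ℕ) [Fact p.Prime]

/-- The twisted complement `T_1` is NOT contained in any conjugate of the torus `T_0` (it is infinite and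
meets every such conjugate trivially, `Iw.range_bHom_inf_conj_eq_bot_of_ne`).
[cite: MochizukiSemiAnbd2006, Def 2.4(iv) p.26] -/
theorem range_bHom_one_not_le_conj_range_bHom_zero (g : Iw p) :
    ¬ (Iw.bHom (p := p) 1).toMonoidHom.range ≤
        ((Iw.bHom (p := p) 0).toMonoidHom.range).map (MulAut.conj g).toMonoidHom := by
  intro hle
  have hbot := Iw.range_bHom_inf_conj_eq_bot_of_ne (p := p) (c := 1) (c' := 0) (Or.inr ⟨rfl, rfl⟩) g
  obtain ⟨u, hu⟩ := exists_ne (1 : IwU p)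
  have hmem : Iw.bHom (p := p) 1 u ∈ (Iw.bHom (p := p) 1).toMonoidHom.range ⊓
      ((Iw.bHom (p := p) 0).toMonoidHom.range).map (MulAut.conj g).toMonoidHom :=
    ⟨⟨u, rfl⟩, hle ⟨u, rfl⟩⟩
  rw [hbot, Subgroup.mem_bot] at hmem
  exact hu (Iw.bHom_injective 1 (by rw [hmem, map_one]))

/-- **No morphism `F : cuspGraph p → cuspGraph p` of semi-graphs of anabelioids is chart-compatible with the
shear** `(a, s) ↦ (a + s, s)` of `π₁^temp(cuspGraph p) = P` (the inner clause of (S3)/`Cor311Compatible` at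
the vertex, for the explicit chart `cuspChart p`): testing against the verticial homomorphism `id_P` on both
sides gives `shear 1 = Inn(g) ∘ F_v`; the branch compatibility of `F` (Rmk. 2.4.2) gives
`F_v(T_0) ⊆ g′ T_0 g′⁻¹`; hence `T_1 = shear 1 (T_0) ⊆ (g g′) T_0 (g g′)⁻¹` — impossible.
[cite: MochizukiSemiAnbd2006, Cor 3.11 p.46] -/
theorem not_chartCompatible_shear (F : Hom (cuspGraph p) (cuspGraph p)) :
    ¬ ∀ (v : (cuspGraph p).graph.Vertex) (ψα : (cuspGraph p).Gv v →ₜ* (cuspChart p).G)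
        (ψβ : (cuspGraph p).Gv (F.base.vertexMap v) →ₜ* (cuspChart p).G),
        IsVerticialHom (cuspChart p) v ψα → IsVerticialHom (cuspChart p) (F.base.vertexMap v) ψβ →
          ∃ g : (cuspChart p).G, ∀ x, Iw.shear (p := p) 1 (ψα x) = g * ψβ (F.hV v x) * g⁻¹ := by
  intro h
  obtain ⟨g, hg⟩ := h PUnit.unit (ContinuousMonoidHom.id (Iw p)) (ContinuousMonoidHom.id (Iw p))
    (isVerticialHom_id_cuspChart p PUnit.unit) (isVerticialHom_id_cuspChart p (F.base.vertexMap PUnit.unit))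
  -- branch compatibility of `F` at the abutting branch: `F_v(T_0) ⊆ g' T_0 g'⁻¹`
  obtain ⟨g', hg'⟩ := F.comm true PUnit.unit rfl
  -- retype everything in `P`
  obtain ⟨g, rfl⟩ : ∃ g₀ : Iw p, g₀ = g := ⟨g, rfl⟩
  obtain ⟨g', rfl⟩ : ∃ g₀ : Iw p, g₀ = g' := ⟨g', rfl⟩
  let fV : Iw p →ₜ* Iw p := F.hV PUnit.unit
  have h1 : ∀ u : IwU p, Iw.bHom (p := p) 1 u = g * fV (Iw.bHom (p := p) 0 u) * g⁻¹ := fun u => by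
    rw [← Iw.shear_bHom_zero 1 u]
    exact hg (Iw.bHom (p := p) 0 u)
  have h2 : ∀ u : IwU p, ∃ u' : IwU p, fV (Iw.bHom (p := p) 0 u) = g' * Iw.bHom (p := p) 0 u' * g'⁻¹ :=
    fun u => ⟨_, hg' u⟩
  apply range_bHom_one_not_le_conj_range_bHom_zero p (g * g')
  rintro _ ⟨u, rfl⟩
  obtain ⟨u', hu'⟩ := h2 u
  refine ⟨Iw.bHom (p := p) 0 u', ⟨u', rfl⟩, ?_⟩
  change (g * g') * Iw.bHom (p := p) 0 u' * (g * g')⁻¹ = Iw.bHom (p := p) 1 u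
  rw [h1 u, hu']
  group

/-! ### One certified special fibre with a cusp violates (S3) and (S3′) -/

/-- **ONE certified special fibre with a cusp violates the typed (S3) and (S3′).**  Over `ℚ_p` there are a
tempered arithmetic group `D` and a special-fibre datum `S` on it with `S.Gc = cuspGraph p` (chart
`cuspChart p`, `π₁^temp = P`; admissible quotient an isomorphism `Δ ⥲ P`, model of abc-iut-f-106) such that
for EVERY pair of origins `Ωα`, `Ωβ` over `ℚ_p` certifying `S`: `¬ SpecialFibreIsoOfChartIso Ωα Ωβ` and
`¬ SpecialFibreIsoOfDescendedIso Ωα Ωβ` — the chart automorphism `shear 1` (descended from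
`γ := adm⁻¹ ∘ shear 1 ∘ adm`) is realised by no isomorphism `G^c ⥲ G^c` of semi-graphs of anabelioids.
[cite: MochizukiSemiAnbd2006, Cor 3.11 pp.46-48] -/
theorem exists_cuspDatum_not_S3 :
    ∃ (D : TemperedArithmeticGroup ℚ_[p]) (S : SpecialFibreData D), S.Gc = cuspGraph p ∧
      ∀ (Ωα Ωβ : SpecialFibreOrigin ℚ_[p]), Ωα.IsSpecialFibreOf D S → Ωβ.IsSpecialFibreOf D S →
        ¬ SpecialFibreIsoOfChartIso Ωα Ωβ ∧ ¬ SpecialFibreIsoOfDescendedIso Ωα Ωβ := by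
  obtain ⟨D, -, -, ⟨ι⟩⟩ := TemperedArithmeticGroup.exists_padic_specialFibreModel p (cuspGraph p)
    (cuspGraph_thm37Hypotheses p) (cuspChart p)
  let adm : D.delta →ₜ* (cuspChart p).G := ⟨ι.toMulEquiv.toMonoidHom, by exact map_continuous ι⟩
  have hadm : Function.Surjective adm := fun g => ⟨ι.symm g, ι.apply_symm_apply g⟩
  let S : SpecialFibreData D :=
    { Gc := cuspGraph p, hyp := cuspGraph_thm37Hypotheses p, chart := cuspChart p, admissible := adm,
      admissible_surjective := hadm }
  -- the descent datum for (S3′): `γ := ι⁻¹ ∘ shear 1 ∘ ι`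
  let γ : D.delta ≃ₜ* D.delta := ι.trans ((Iw.shear (p := p) 1).trans ι.symm)
  have hγ : ∀ x : D.delta, Iw.shear (p := p) 1 (adm x) = adm (γ x) := fun x => by
    change Iw.shear (p := p) 1 (ι x) = ι (ι.symm (Iw.shear (p := p) 1 (ι x)))
    rw [ι.apply_symm_apply]
  refine ⟨D, S, rfl, fun Ωα Ωβ hα hβ => ⟨fun h => ?_, fun h => ?_⟩⟩
  · obtain ⟨F, -, hc, -⟩ := h D D S S hα hβ (Iw.shear (p := p) 1)
    exact not_chartCompatible_shear p F hc
  · obtain ⟨F, -, hc, -⟩ := h D D S S hα hβ γ (Iw.shear (p := p) 1) hγ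
    exact not_chartCompatible_shear p F hc

/-- In particular (all-certifying origins again, now from ONE datum): the universal closures of (S3) and (S3′)
fail — a third, independent kernel route to the F-1727 / F-3254 verdicts.
[cite: MochizukiSemiAnbd2006, Cor 3.11 pp.46-48] -/
theorem not_S3_and_not_S3'_of_allCertifying (Ωα Ωβ : SpecialFibreOrigin ℚ_[p])
    (hα : ∀ D S, Ωα.IsSpecialFibreOf D S) (hβ : ∀ D S, Ωβ.IsSpecialFibreOf D S) :
    ¬ SpecialFibreIsoOfChartIso Ωα Ωβ ∧ ¬ SpecialFibreIsoOfDescendedIso Ωα Ωβ := by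
  obtain ⟨D, S, -, h⟩ := exists_cuspDatum_not_S3 p
  exact h Ωα Ωβ (hα D S) (hβ D S)

/-! ### F-1721: the typed `Cor311` itself fails at ONE certified cusp datum (same prime on both sides) -/

/-- **The typed Corollary 3.11 `Cor311 p p` fails at every origin pair certifying the single cusp datum**
(FACT-LIST F-1721; complements abc-iut-f-106's `exists_not_cor311`, which refutes the closure through the
clause `p_α = p_β` at all-certifying origins over `ℚ_2`, `ℚ_3`): here the prime is THE SAME on both sides and
the ISOMORPHISM clause fails — for `γ := adm⁻¹ ∘ shear 1 ∘ adm : Δ ⥲ Δ` the descended chart isomorphism is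
forced to be `shear 1` (`SpecialFibreData.descended_unique`), which no isomorphism `G^c ⥲ G^c` of semi-graphs
of anabelioids realises (`not_chartCompatible_shear`).  A statement about OUR typing at a certified TOY datum
(print's `Δ[□]` is the tempered fundamental group of a curve); nothing of [SemiAnbd] is refuted.
[cite: MochizukiSemiAnbd2006, Cor 3.11 pp.45-46] -/
theorem exists_cuspDatum_not_cor311 :
    ∃ (D : TemperedArithmeticGroup ℚ_[p]) (S : SpecialFibreData D), S.Gc = cuspGraph p ∧
      ∀ (Ωα Ωβ : SpecialFibreOrigin ℚ_[p]), Ωα.IsSpecialFibreOf D S → Ωβ.IsSpecialFibreOf D S →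
        ¬ Literature.AnabelianGeometry.SemiGraphs.Cor311 p p Ωα Ωβ := by
  obtain ⟨D, -, -, ⟨ι⟩⟩ := TemperedArithmeticGroup.exists_padic_specialFibreModel p (cuspGraph p)
    (cuspGraph_thm37Hypotheses p) (cuspChart p)
  let adm : D.delta →ₜ* (cuspChart p).G := ⟨ι.toMulEquiv.toMonoidHom, by exact map_continuous ι⟩
  have hadm : Function.Surjective adm := fun g => ⟨ι.symm g, ι.apply_symm_apply g⟩
  let S : SpecialFibreData D :=
    { Gc := cuspGraph p, hyp := cuspGraph_thm37Hypotheses p, chart := cuspChart p, admissible := adm,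
      admissible_surjective := hadm }
  let γ : D.delta ≃ₜ* D.delta := ι.trans ((Iw.shear (p := p) 1).trans ι.symm)
  have hγ : ∀ x : D.delta, Iw.shear (p := p) 1 (S.admissible x) = S.admissible (γ x) := fun x => by
    change Iw.shear (p := p) 1 (ι x) = ι (ι.symm (Iw.shear (p := p) 1 (ι x)))
    rw [ι.apply_symm_apply]
  refine ⟨D, S, rfl, fun Ωα Ωβ hα hβ h => ?_⟩
  obtain ⟨⟨F, -, ⟨φ, hφ, hc⟩, -⟩, -⟩ := h D D S S hα hβ γ
  obtain rfl : φ = Iw.shear (p := p) 1 := S.descended_unique S γ hγ hφ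
  exact not_chartCompatible_shear p F hc

end IwahoriWitness

end Literature.AnabelianGeometry.SemiGraphs

end
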